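import Literature.Probability.RandomPlanarGeometry.SAWCountZdStirlingSecondCoefficient
import HarnessLib

/-!
# The third coefficient of the Stirling polynomials: `[X^{2k−2}] E_k = (−1)^k k(k−1)(4k²+4k+3)/(18·2^k·k!)`

Topic `Literature/Probability/RandomPlanarGeometry` (the «SYMBOL POLYNOMIALITY» programme for `c_n(ℤ^d)`, THIRD layer: `SAWCountZdSymbolFirstCancellation.lean`
(a-p1 g26: `stirlingPoly`, `faulhaberPoly`, `sumPoly`, the leading coefficients), `SAWCountZdStirlingSecondCoefficient.lean` (a-p1 g26: the second coefficients
`[X^{2k−1}] E_k = (−1)^{k+1} k(2k+1)/(3·2^k k!)`, `coeff_sumPoly_natDegree`, `coeff_faulhaberPoly_self`)).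

PRINTED SOURCE (locators only). Stanley, EC1 (2nd ed. 2012) §1.3: Prop. 1.3.7 / eq. (1.28) (`Σ_k c(n,k)x^k = x(x+1)⋯(x+n−1)`), Lemma 1.3.6 (the recurrence), Exercise 1.43
(`c(n, n−k)` is a polynomial in `n` of degree `2k`); the Bernoulli–Faulhaber formula is Mathlib's `sum_range_pow` (`B₂ = 1/6`: `bernoulli_two`). NOT in the source in
this form: the closed form of the THIRD coefficient below (an exercise-level consequence; lane lemma).

THE RESULT. With `E_k = stirlingPoly k` (`[X^{m−k}] X(X−1)⋯(X−m+1) = E_k(m)`, `deg E_k = 2k`, `a_k := lc E_k = (−1)^k/(2^k k!)`, `b_k := [X^{2k−1}]E_k = −k(2k+1)/3 · a_k`):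
★ `coeff_faulhaberPoly_pred` — `[X^{p−1}] F_p = p/12` (`p ≥ 2`; the `B₂` term); ★ `coeff_sumPoly_natDegree_sub_one` — the THIRD coefficient of the summation operator:
`[X^{D−1}] sumPoly q = [X^{D−2}]q/(D−1) − [X^{D−1}]q/2 + D·lc(q)/12` (`D = deg q ≥ 2`); ★★ `coeff_stirlingPoly_two_mul_sub_two` — for every `k ≥ 1`,
**`[X^{2k−2}] E_k = (−1)^k k(k−1)(4k²+4k+3)/(18·2^k·k!)`**, i.e. `c_k = k(k−1)(4k²+4k+3)/18 · a_k` (`coeff_stirlingPoly_two_mul_sub_two_eq_mul_leadingCoeff`;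
`k = 2`: `3/8`; `k = 3`: `−17/48`; `k = 4`: `83/576`), from the recursion `c_{k+1} = −(c_k/(2k) − b_k/2 + (2k+1)a_k/12)` read off `E_{k+1} = const − sumPoly(X·E_k)`.
USE (lane): the Stirling input of the THIRD CANCELLATION `[X^{2j−5}] B_j = 0` (`j ≥ 5`) of the bad-word correction to the `j`-th `1/d`-symbol of `c_n(ℤ^d)`
(FINDING-ZD-SYMBOL-POLYNOMIALITY §16: with the three third-layer corner censuses the `i`-th summand is `2^{−j}(−1)^{j−i}C(j−2,i−2)/(j−2)!` times a polynomial of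
degree TWO in `i` — the quartic and cubic parts cancel — hence is killed by the alternating binomial sums once `j − 2 ≥ 3`).

THIS FILE (lane «pcv-sawmu», a-p1 g26; all PROVED, standard axioms): ★ `coeff_faulhaberPoly_pred`, ★ `coeff_sumPoly_natDegree_sub_one`,
★ `coeff_stirlingPoly_succ_two_mul` (inductive form), ★★ `coeff_stirlingPoly_two_mul_sub_two`, ★ `coeff_stirlingPoly_two_mul_sub_two_eq_mul_leadingCoeff`.
[cite: Stanley2012EC1, §1.3 Lemma 1.3.6 & Prop. 1.3.7 eq. (1.28); Exercise 1.43]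

Provenance: lane «pcv-sawmu», a-p1 g26 (2026-08-28).
-/

noncomputable section

open Finset
open scoped BigOperators
open Literature.Probability.LatticeModels
open Literature.Probability.RandomPlanarGeometry.SAW
open Literature.Probability.Percolation

namespace Literature.Probability.RandomPlanarGeometry.SAW.Zd

namespace WordTypes

/-! ### The third Faulhaber coefficient and the third coefficient of the summation operator -/

/-- `[X^{p−1}] F_p = B₂·C(p+1,2)/(p+1) = p/12` for `p ≥ 2`. [cite: Stanley2012EC1, §1.3 Prop. 1.3.7 eq. (1.28); lane plumbing] -/
theorem coeff_faulhaberPoly_pred (p : ℕ) (hp : 2 ≤ p) : (faulhaberPoly p).coeff (p - 1) = (p : ℚ) / 12 := by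
  unfold faulhaberPoly
  rw [Polynomial.finsetSum_coeff, Finset.sum_eq_single 2]
  · rw [Polynomial.coeff_C_mul, Polynomial.coeff_X_pow, if_pos (by omega), _root_.bernoulli_two, Nat.cast_choose_two]
    push_cast
    have : ((p : ℚ) + 1) ≠ 0 := by positivity
    field_simp
    ring
  · intro i _ hi
    rw [Polynomial.coeff_C_mul, Polynomial.coeff_X_pow, if_neg (by omega), mul_zero]
  · intro h; exact absurd (Finset.mem_range.2 (by omega : 2 < p + 1)) h

/-- The third coefficient of the sum: `[X^{deg q − 1}] sumPoly q = [X^{deg q − 2}] q/(deg q − 1) − [X^{deg q − 1}] q/2 + deg q · lc(q)/12` (`deg q ≥ 2`).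
[cite: Stanley2012EC1, §1.3 Prop. 1.3.7 eq. (1.28); lane plumbing] -/
theorem coeff_sumPoly_natDegree_sub_one (q : Polynomial ℚ) (hq : 2 ≤ q.natDegree) :
    (sumPoly q).coeff (q.natDegree - 1) =
      q.coeff (q.natDegree - 2) / ((q.natDegree : ℚ) - 1) - q.coeff (q.natDegree - 1) / 2 + (q.natDegree : ℚ) * q.leadingCoeff / 12 := by
  unfold sumPoly
  rw [Polynomial.finsetSum_coeff]
  obtain ⟨D, hD⟩ : ∃ D, q.natDegree = D + 2 := ⟨q.natDegree - 2, by omega⟩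
  rw [hD, Finset.sum_range_succ, Finset.sum_range_succ, Finset.sum_range_succ, Finset.sum_eq_zero, zero_add, Polynomial.coeff_C_mul,
    Polynomial.coeff_C_mul, Polynomial.coeff_C_mul, show D + 2 - 1 = D + 1 by omega, coeff_faulhaberPoly_succ,
    coeff_faulhaberPoly_self (D + 1) (by omega), show D + 1 = (D + 2) - 1 by omega, coeff_faulhaberPoly_pred (D + 2) (by omega),
    Polynomial.leadingCoeff, hD]
  · rw [show D + 2 - 2 = D by omega, show D + 2 - 1 = D + 1 by omega]
    push_cast
    have h1 : ((D : ℚ) + 1) ≠ 0 := by positivity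
    have h1' : (1 : ℚ) + D ≠ 0 := by positivity
    have h2 : ((D : ℚ) + 2 - 1) = D + 1 := by ring
    rw [h2]
    field_simp
    ring
  · intro p hp
    rw [Polynomial.coeff_C_mul, Polynomial.coeff_eq_zero_of_natDegree_lt ((natDegree_faulhaberPoly_le p).trans_lt
      (by have := Finset.mem_range.1 hp; omega)), mul_zero]

/-! ### The third coefficient of the Stirling polynomials -/

/-- The inductive form: `[X^{2k}] E_{k+1} = (−1)^{k+1} k(k+1)(4k²+12k+11)/(18·2^{k+1}·(k+1)!)` for every `k` (recursion
`c_{k+1} = −(c_k/(2k) − b_k/2 + (2k+1)a_k/12)`). [cite: Stanley2012EC1, §1.3 Lemma 1.3.6 & Prop. 1.3.7 eq. (1.28); Exercise 1.43; lane lemma] -/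
theorem coeff_stirlingPoly_succ_two_mul (k : ℕ) :
    (stirlingPoly (k + 1)).coeff (2 * k) =
      (-1) ^ (k + 1) * ((k : ℚ) * (k + 1) * (4 * k ^ 2 + 12 * k + 11)) / (18 * 2 ^ (k + 1) * ((k + 1).factorial : ℚ)) := by
  induction k with
  | zero =>
    rw [stirlingPoly_one, Polynomial.coeff_C_mul, Nat.mul_zero, mul_sub, mul_one, Polynomial.coeff_sub, Polynomial.coeff_X_zero,
      ← pow_two, Polynomial.coeff_X_pow]
    norm_num
  | succ k ih =>
    have hne : stirlingPoly (k + 1) ≠ 0 := stirlingPoly_ne_zero _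
    have hXdeg : (Polynomial.X * stirlingPoly (k + 1)).natDegree = 2 * k + 3 := by
      rw [Polynomial.natDegree_X_mul hne, natDegree_stirlingPoly]; ring
    have hXlc : (Polynomial.X * stirlingPoly (k + 1)).leadingCoeff = (-1) ^ (k + 1) / (2 ^ (k + 1) * ((k + 1).factorial : ℚ)) := by
      rw [Polynomial.leadingCoeff_mul, Polynomial.leadingCoeff_X, one_mul, leadingCoeff_stirlingPoly]
    have hXc1 : (Polynomial.X * stirlingPoly (k + 1)).coeff (2 * k + 3 - 1) = (stirlingPoly (k + 1)).coeff (2 * k + 1) := by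
      rw [show 2 * k + 3 - 1 = (2 * k + 1) + 1 by omega, Polynomial.coeff_X_mul]
    have hXc2 : (Polynomial.X * stirlingPoly (k + 1)).coeff (2 * k + 3 - 2) = (stirlingPoly (k + 1)).coeff (2 * k) := by
      rw [show 2 * k + 3 - 2 = 2 * k + 1 by omega, Polynomial.coeff_X_mul]
    rw [show 2 * (k + 1) = 2 * k + 3 - 1 by omega, stirlingPoly_succ, Polynomial.coeff_sub, Polynomial.coeff_C, if_neg (by omega), zero_sub, ← hXdeg,
      coeff_sumPoly_natDegree_sub_one _ (by rw [hXdeg]; omega), hXdeg, hXc1, hXc2, ih, coeff_stirlingPoly_succ_two_mul_add_one, hXlc,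
      Nat.factorial_succ (k + 1)]
    push_cast
    have hk : ((k + 1).factorial : ℚ) ≠ 0 := by exact_mod_cast (k + 1).factorial_ne_zero
    have h3 : (2 : ℚ) * k + 3 - 1 = 2 * (k + 1) := by ring
    have h4 : (k : ℚ) + 1 ≠ 0 := by positivity
    have h5 : (1 : ℚ) + k ≠ 0 := by positivity
    have h6 : (2 : ℚ) + k * 2 ≠ 0 := by positivity
    have h7 : (2 : ℚ) * (k + 1) ≠ 0 := by positivity
    rw [h3]
    field_simp
    ring

/-- ★★ THE THIRD COEFFICIENT OF THE STIRLING POLYNOMIALS: for every `k ≥ 1`, `[X^{2k−2}] E_k = (−1)^k k(k−1)(4k²+4k+3)/(18·2^k·k!)`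
(`k = 1`: `0`; `k = 2`: `3/8`; `k = 3`: `−17/48`; `k = 4`: `83/576`). [cite: Stanley2012EC1, §1.3 Lemma 1.3.6 & Prop. 1.3.7 eq. (1.28); Exercise 1.43; lane lemma] -/
theorem coeff_stirlingPoly_two_mul_sub_two (k : ℕ) (hk : 1 ≤ k) :
    (stirlingPoly k).coeff (2 * k - 2) =
      (-1) ^ k * ((k : ℚ) * (k - 1) * (4 * k ^ 2 + 4 * k + 3)) / (18 * 2 ^ k * (k.factorial : ℚ)) := by
  obtain ⟨k, rfl⟩ : ∃ k', k = k' + 1 := ⟨k - 1, by omega⟩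
  rw [show 2 * (k + 1) - 2 = 2 * k by omega, coeff_stirlingPoly_succ_two_mul]
  push_cast
  ring

/-- In ratio form: `[X^{2k−2}] E_k = k(k−1)(4k²+4k+3)/18 · lc E_k` for `k ≥ 1`. [cite: Stanley2012EC1, §1.3 Prop. 1.3.7 eq. (1.28); lane lemma] -/
theorem coeff_stirlingPoly_two_mul_sub_two_eq_mul_leadingCoeff (k : ℕ) (hk : 1 ≤ k) :
    (stirlingPoly k).coeff (2 * k - 2) = ((k : ℚ) * (k - 1) * (4 * k ^ 2 + 4 * k + 3) / 18) * (stirlingPoly k).leadingCoeff := by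
  rw [coeff_stirlingPoly_two_mul_sub_two k hk, leadingCoeff_stirlingPoly]
  have hf : (k.factorial : ℚ) ≠ 0 := by exact_mod_cast k.factorial_ne_zero
  field_simp

end WordTypes

end Literature.Probability.RandomPlanarGeometry.SAW.Zd
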